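import Summits.AnomalousDissipation.AnomalousDissipation.Theses.TaylorCertificates
import Summits.AnomalousDissipation.AnomalousDissipation.Theorems.TaylorCertificatePair.Negative.Modes
import Literature.Analysis.FunctionSpaces.TorusFluidGlueProofs
import Literature.Analysis.FunctionSpaces.TorusCalculusProofs
import Literature.Analysis.FunctionSpaces.TorusTestFunction

/-!
# Stub `stub_headTransport` of the line `Sketch` (helical path) for the crux
# `TaylorCertificates.SmoothEulerCoerciveForce` (stmt-AnomalousDissipation-14097)

Transport of the Bernoulli head along a classical steady forced Euler field on `T³`
(general force).  If `v`, `p` are smooth and `(v·∇)v + ∇p = f` holds pointwise, then the head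
`H := p + |v|² / 2` changes along streamlines at the rate of working of the force:
`DH(x)[v x] = ⟪f x, v x⟫` for every `x ∈ T³`.

Proof (pure calculus over the tree's torus calculus, `Torus.fderiv f x = fderiv (liftAt f x) 0`):
`D(p + ½|v|²)(x)[w] = Dp(x)[w] + ½ · 2⟪v x, Dv(x)[w]⟫` (`Torus.fderiv_add`,
`Torus.fderiv_const_smul`, `Torus.fderiv_norm_sq_apply`); with `w := v x`,
`Dp(x)[v x] = ⟪∇p x, v x⟫` (`Torus.inner_gradient_left`) and `Dv(x)[v x] = (v·∇)v (x)`
(`Torus.convect`, by definition), so the sum is `⟪(v·∇)v x + ∇p x, v x⟫ = ⟪f x, v x⟫`.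

References: standard (Bernoulli's theorem for steady Euler flows, e.g. Chorin–Marsden,
*A Mathematical Introduction to Fluid Mechanics*, §1.2); the skeleton
`Theorems/SmoothEulerCoerciveForce` of the line `Sketch` (hypothesis `hhead` of `stub_helicalCore`).
NOT here: the work identity, the strong form, the Lamb form, the vorticity equation, the core.
-/

-- `Summit.<Summit>.<Problem>` is the tree's mandated summit-side namespace (CONVENTIONS §2); for this
-- single-conjunct summit the two coincide, so the duplicate is deliberate.
set_option linter.dupNamespace false

noncomputable section

open MeasureTheory
open scoped InnerProductSpace

namespace Summit.AnomalousDissipation.AnomalousDissipation.Theorems.SmoothEulerCoerciveForce.Helical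

open Literature.Analysis.FunctionSpaces
open Summit.AnomalousDissipation.AnomalousDissipation.Theses.TaylorCertificates
open Summit.AnomalousDissipation.AnomalousDissipation.Theorems.TaylorCertificatePair.Negative

/-- **Transport of the Bernoulli head (general force).** If `(v·∇)v + ∇p = f` pointwise on `T³`
with `v`, `p` smooth, then the head `H = p + |v|²/2` is transported along `v` at the rate of
working of the force: `DH(x)[v x] = ⟪f x, v x⟫` (chain rule: `D(|v|²/2)(x)[v x] = ⟪v x, Dv(x)[v x]⟫
= ⟪(v·∇)v x, v x⟫` and `Dp(x)[v x] = ⟪∇p x, v x⟫`). -/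
theorem stub_headTransport
    (f v : UnitAddTorus (Fin 3) → EuclideanSpace ℝ (Fin 3)) (p : UnitAddTorus (Fin 3) → ℝ)
    (hvs : Torus.IsSmooth v) (hp : Torus.IsSmooth p)
    (he : ∀ x, Torus.convect v v x + Torus.gradient p x = f x) :
    ∀ x, Torus.fderiv (fun y => p y + ‖v y‖ ^ 2 / 2) x (v x) = inner ℝ (f x) (v x) := by
  intro x
  have hp1 : Torus.IsContDiff 1 p := hp.isContDiff (by simp)
  have hv1 : Torus.IsContDiff 1 v := hvs.isContDiff (by simp)
  have hn1 : Torus.IsContDiff 1 (fun y => ‖v y‖ ^ 2) := hvs.norm_sq.isContDiff (by simp)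
  -- the head as a sum of `C¹` summands: `H = p + ½ • |v|²`
  have hfun : (fun y => p y + ‖v y‖ ^ 2 / 2) = p + (1 / 2 : ℝ) • (fun y => ‖v y‖ ^ 2) := by
    funext y
    simp only [Pi.add_apply, Pi.smul_apply, smul_eq_mul]
    ring
  rw [hfun, Torus.fderiv_add hp1 (hn1.smul (1 / 2)), Torus.fderiv_const_smul hn1,
    _root_.add_apply, _root_.smul_apply,
    Torus.fderiv_norm_sq_apply hv1, ← Torus.inner_gradient_left p x (v x), ← he x,
    inner_add_left, smul_eq_mul, Torus.convect,
    real_inner_comm (v x) (Torus.fderiv v x (v x))]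
  ring

end Summit.AnomalousDissipation.AnomalousDissipation.Theorems.SmoothEulerCoerciveForce.Helical

end
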